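import Literature.AnabelianGeometry.EtaleTheta.Discharge.Sec5CyclotomicRigidityOfBiKummerDataLaws
import HarnessLib

/-!
# [EtTh] Prop. 5.5 at the assembled §5 data — the Galois leaf (G) `hgal` REDUCED to a base-category law (abc-iut L2, row #5-R43)

Mochizuki, *The étale theta function and its Frobenioid-theoretic manifestations*, Publ. RIMS **45** (2009) 227–349, §5,
Prop. 5.5, proof p.328 (PDF p.102): "we may transport this isomorphism from `S″` to an arbitrary (l, N)-theta-saturated
`S ∈ Ob(C)` by means of linear morphisms `S″ → S`, `S″ → S‴` [of `C` …] … which is independent of the choice of `S″`, `S‴`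
and the linear morphisms" [cite: MochizukiEtTh2009, Prop 5.5 p.328 (PDF p.102)]; [SemiAnbd] Def. 3.1 (iv) p.33 / Rmk. 3.1.3
p.34 (Galois objects of `B^temp(Π)` are the `Π/N`; `Aut(Π/N) = Π/N`) [cite: MochizukiSemiAnbd2006, Rmk 3.1.3 p.34].

PROOF-ONLY (no definitions; seat abc-iut-w4-d099, cell abc-iut layer L2, row #5-R43 «P55/T56 FIXED-SOURCE LEAVES (G) hgal +
hproj at `ofBiKummerData`», L2-lead RULINGS/ROWS #5 (R43)).  abc-iut-w5-d020's
`ThetaFrobenioid.cyclotomicRigidity_ofBiKummerData_of_laws` (Sec5CyclotomicRigidityOfBiKummerDataLaws.lean, p420788) —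
[EtTh] Prop. 5.5 for the §5 data ASSEMBLED from the §3/§4 structures — carries three NAMED structural binders `hgal`, `hproj`,
`hcup` (abc-iut-w4-d008's leaves (G)/(hproj)/(hcup) of `Thm56Sub.cyclotomicRigidity_of_laws`).  Leaf (G) as typed there reads:
for every theta-saturated `T` and LINEAR `φ, φ′ : B_N → T`, the base arrows `φ^bs, φ′^bs : B_N^bs → T^bs` differ by an
automorphism of `B_N^bs`.  FINDING (this row): at `ofBiKummerData` the base category `D` is the ABSTRACT base of the §4 setting
`S : BiKummerSetting` — it knows a Galois object only through ONE surjection `Π^tp_X ↠ Aut_D(A)` (`S.galoisSurj`), with no fibre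
functor — so (G) is NOT derivable there; what it uses of print is exactly the [SemiAnbd]-level property

  (L1)  `∀ A Galois, ∀ T, ∀ b b′ : A ⟶ T, ∃ g ∈ Aut_D(A), b′ = g ≫ b`
        ("a Galois object is an `Aut`-torsor over every [connected] target", PRE-composition transitivity — the dual of the
        tree's categorical `IsGaloisObj` of [SemiAnbd] Def. 3.1 (iv), which is POST-composition transitivity INTO a Galois
        object),

PROVED for the genuine base `B^temp(Π)⁰` in `SemiGraphs/TemperoidsGaloisHomTorsor.lean`
(`GaloisObjects.exists_aut_comp_eq_of_isGaloisObj_connectedPart`; false in `B^temp(Π)` for a disconnected target, hence a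
law of the CONNECTED base `D` of [EtTh] Def. 3.6 (ii)), and carried here — per the BiKummerGaloisSurjLaws pattern
(constructor-locked setting: new properties as named hypotheses, not fields; plan/GAP-LEDGER.md row G-w4d099-1) — as the
hypothesis binder `hGalT` on the setting.  This file:
* `baseTorsor_ofBiKummerData_of_galoisHomTorsor` — (L1) at the Galois `N`-domain `A_N^bs` (Def. 4.1 (iv)(a), `R.αData.isGalois`)
  transported along `(s^⊓_N)^bs : A_N^bs ⥲ B_N^bs` (`BiKummerSetting.NthRoot.baseIso`) gives the torsor property at `B_N^bs` for
  ALL `φ, φ′ : B_N → T` — the hypotheses "theta-saturated"/"linear" of (G) are idle;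
* `linearBaseTorsor_ofBiKummerData_of_galoisHomTorsor` — leaf (G) in EXACTLY the binder shape of p420788;
* `cyclotomicRigidity_ofBiKummerData_of_galoisHomTorsor` — p420788 re-assembled BY NAME with `hgal := ` the above, i.e.
  [EtTh] Prop. 5.5 at the data with the binder list `… hσ hgeom hconst hreach hLc hLi hGalT hproj hcup`.
Leaf `hproj` (orientation: transport of `(l·Δ_Θ)_{B_N^bs}` along an automorphism `g` of `B_N^bs` = conjugation by `g` through
the projection `P`) stays NAMED: at `ofBiKummerData` the subquotient stub `Q` and `P : ThetaSubquotientProj` are FREE data, so it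
is a law on the pair `(Q, P)` (GAP-LEDGER G-w4d099-2; dischargeable only at the genuine subquotients of abc-iut-L2-t9's
`ThetaSubquotientOfTempered`, whose `Aut`-projection companion is not in the tree).  `hcup` is abc-iut-L6-t23's row.
Nothing of [EtTh] is asserted; typed ≠ proved for the named binders; no side taken on [IUTchIII] Cor. 3.12.
-/

noncomputable section

namespace Literature.AnabelianGeometry.EtaleTheta

open CategoryTheory Opposite FrobenioidCyclotomicRigidity Literature.AlgebraicGeometry.Frobenioids

universe u₀ v₀ u v w

namespace ThetaFrobenioid

variable {K : Type u₀} [Field K]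
  {X : SemiGraphs.TemperedArithmeticGroup.{u₀} K} {D₀ : Type u₀} [Category.{v₀} D₀]
  {V : FrdIMonoidStub.{w}} {T₀ : RealifiedDivisorMonoids (D₀ := D₀) V} {D : Type u} [Category.{v} D]
  {VD : FrdICatStub.{u, v, w} D} {S : BiKummerSetting X T₀ D VD}
  {pullFrac : ∀ {A A' : S.C} (_ : A' ⟶ A), S.biratUnits A → S.biratUnits A'}
  {lv N : ℕ+} {l' : ℕ} {RD : RigidData.{max v w} N l'} {θ : S.biratUnits S.Aodot} {Bl : S.C}
  {Pl : S.FractionPair θ Bl} {Rl : S.NthRoot θ Pl lv pullFrac}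
  (h : ModelFrobenioid.Hypotheses S.tf.divisorMonoid S.tf.ratFnFunctor)
  (toB : ∀ A : S.C, S.biratUnits A →* S.tf.biratUnitsModel A) (Q : FrobenioidTheta.ThetaSubquotientStub.{w} D)
  (odd_l : Odd (lv : ℕ)) (R : S.NthRoot Rl.root Rl.pair N pullFrac) (ιX : RD.PiX ≃ₜ* X.Pi)
  (hopen : IsOpen ((S.galoisSurj R.AN.base R.αData.isGalois).ker : Set X.Pi)) (σ : Aut R.AN.base →* Aut R.AN)
  (K' : Type w) [Field K'] (constEmb : K'ˣ →* S.tf.biratUnitsModel R.BN)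
  (constEmb_injective : Function.Injective constEmb)
  (hdivc : ∀ g : Aut R.BN.base,
    ModelFrobenioid.div ((σ ((BiKummerSetting.NthRoot.baseIso S R).conjAut.symm g)).hom ≫ R.pair.num) =
      ModelFrobenioid.div R.pair.num)
  (hdivp : ∀ y : RD.PiYdd,
    ModelFrobenioid.div ((σ (S.galoisSurj R.AN.base R.αData.isGalois (ιX y.1))).hom ≫ R.pair.den) =
      ModelFrobenioid.div R.pair.den)

/-! ### Leaf (G) from the base-category law (L1) -/

/-- **(L1) at `A_N^bs`, transported to `B_N^bs`:** if every Galois object of `D` is an `Aut`-torsor over every target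
(law (L1), binder `hGalT`), then for ANY two morphisms `φ, φ′ : B_N → T` of `C` the base arrows differ by an automorphism of
`B_N^bs`: `φ′^bs = g ≫ φ^bs` — via the Galois `N`-domain `A_N^bs` (Def. 4.1 (iv)(a)) and `(s^⊓_N)^bs : A_N^bs ⥲ B_N^bs`.
[cite: MochizukiEtTh2009, Prop 5.5 p.328 (PDF p.102)] -/
theorem baseTorsor_ofBiKummerData_of_galoisHomTorsor
    (hGalT : ∀ ⦃A : D⦄, S.IsGaloisObj A → ∀ ⦃T : D⦄ (b b' : A ⟶ T), ∃ g : Aut A, b' = g.hom ≫ b)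
    (T : S.C) (φ φ' : (ofBiKummerData h toB Q odd_l R ιX hopen σ K' constEmb constEmb_injective hdivc hdivp).BN ⟶ T) :
    ∃ g : Aut ((ofBiKummerData h toB Q odd_l R ιX hopen σ K' constEmb constEmb_injective hdivc hdivp).base.obj
        (ofBiKummerData h toB Q odd_l R ιX hopen σ K' constEmb constEmb_injective hdivc hdivp).BN),
      (ofBiKummerData h toB Q odd_l R ιX hopen σ K' constEmb constEmb_injective hdivc hdivp).base.map φ' =
        g.hom ≫ (ofBiKummerData h toB Q odd_l R ιX hopen σ K' constEmb constEmb_injective hdivc hdivp).base.map φ := by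
  change ∃ g : Aut R.BN.base, ModelFrobenioid.baseMap φ' = g.hom ≫ ModelFrobenioid.baseMap φ
  obtain ⟨g, hg⟩ := hGalT R.αData.isGalois ((BiKummerSetting.NthRoot.baseIso S R).hom ≫ ModelFrobenioid.baseMap φ)
    ((BiKummerSetting.NthRoot.baseIso S R).hom ≫ ModelFrobenioid.baseMap φ')
  refine ⟨(BiKummerSetting.NthRoot.baseIso S R).conjAut g, ?_⟩
  rw [Iso.conjAut_hom, Iso.conj_apply, Category.assoc, Category.assoc]
  exact ((BiKummerSetting.NthRoot.baseIso S R).eq_inv_comp).mpr hg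

/-- **Leaf (G) `hgal` of `cyclotomicRigidity_ofBiKummerData_of_laws`, DERIVED from the law (L1)** — in exactly that binder's
shape (theta-saturated `T`, linear `φ, φ′ : B_N → T`; both hypotheses are idle). [cite: MochizukiEtTh2009, Prop 5.5 p.328 (PDF p.102)] -/
theorem linearBaseTorsor_ofBiKummerData_of_galoisHomTorsor
    (hGalT : ∀ ⦃A : D⦄, S.IsGaloisObj A → ∀ ⦃T : D⦄ (b b' : A ⟶ T), ∃ g : Aut A, b' = g.hom ≫ b) :
    ∀ (T : S.C),
      (ofBiKummerData h toB Q odd_l R ιX hopen σ K' constEmb constEmb_injective hdivc hdivp).IsThetaSaturated T →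
      ∀ (φ φ' : (ofBiKummerData h toB Q odd_l R ιX hopen σ K' constEmb constEmb_injective hdivc hdivp).BN ⟶ T),
        (ofBiKummerData h toB Q odd_l R ιX hopen σ K' constEmb constEmb_injective hdivc hdivp).IsLinear φ →
        (ofBiKummerData h toB Q odd_l R ιX hopen σ K' constEmb constEmb_injective hdivc hdivp).IsLinear φ' →
          ∃ g : Aut ((ofBiKummerData h toB Q odd_l R ιX hopen σ K' constEmb constEmb_injective hdivc hdivp).base.obj
              (ofBiKummerData h toB Q odd_l R ιX hopen σ K' constEmb constEmb_injective hdivc hdivp).BN),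
            (ofBiKummerData h toB Q odd_l R ιX hopen σ K' constEmb constEmb_injective hdivc hdivp).base.map φ' =
              g.hom ≫ (ofBiKummerData h toB Q odd_l R ιX hopen σ K' constEmb constEmb_injective hdivc hdivp).base.map φ :=
  fun T _ φ φ' _ _ =>
    baseTorsor_ofBiKummerData_of_galoisHomTorsor h toB Q odd_l R ιX hopen σ K' constEmb constEmb_injective hdivc hdivp
      hGalT T φ φ'

/-! ### [EtTh] Prop. 5.5 at the data with leaf (G) replaced by the law (L1) -/

/-- **[EtTh] Proposition 5.5 for the ASSEMBLED §5 data — leaf (G) reduced to the base-category law (L1)**: abc-iut-w5-d020's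
`cyclotomicRigidity_ofBiKummerData_of_laws` BY NAME with its binder `hgal` supplied by
`linearBaseTorsor_ofBiKummerData_of_galoisHomTorsor hGalT`; every other binder verbatim (`hproj`, `hcup` stay named).
[cite: MochizukiEtTh2009, Prop 5.5 p.327–328 (PDF pp.101–102)] -/
theorem cyclotomicRigidity_ofBiKummerData_of_galoisHomTorsor
    (hB : (ofBiKummerData h toB Q odd_l R ιX hopen σ K' constEmb constEmb_injective hdivc hdivp).IsThetaSaturated
      (ofBiKummerData h toB Q odd_l R ιX hopen σ K' constEmb constEmb_injective hdivc hdivp).BN)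
    (P : ThetaSubquotientProj (ofBiKummerData h toB Q odd_l R ιX hopen σ K' constEmb constEmb_injective hdivc hdivp))
    {η₀ : RD.PiYdd → RD.mu} (hη₀ : η₀ ∈ RD.thetaCocycles)
    (hdies : ∀ k : RD.PiYdd, rhoOfBiKummerData R ιX k = 1 → η₀ k = 1)
    (e : RD.mu → (ofBiKummerData h toB Q odd_l R ιX hopen σ K' constEmb constEmb_injective hdivc hdivp).lDeltaModN
      (ofBiKummerData h toB Q odd_l R ιX hopen σ K' constEmb constEmb_injective hdivc hdivp).BN)
    (he : Function.Surjective e)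
    (hlift : ∀ a ∈ (ofBiKummerData h toB Q odd_l R ιX hopen σ K' constEmb constEmb_injective hdivc hdivp).HB,
      a ∈ P.pre _ → ∃ k : RD.PiYdd, (k : RD.PiX) ∈ RD.lDeltaTheta ∧ rhoOfBiKummerData R ιX k = a)
    (hpre : ∀ k : RD.PiYdd, (k : RD.PiX) ∈ RD.lDeltaTheta → rhoOfBiKummerData R ιX k ∈ P.pre _)
    (hP : ∀ (k : RD.PiYdd) (hk : (k : RD.PiX) ∈ RD.lDeltaTheta) (hm : rhoOfBiKummerData R ιX k ∈ P.pre _),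
      (QuotientGroup.mk (P.proj _ ⟨rhoOfBiKummerData R ιX k, hm⟩) :
          (ofBiKummerData h toB Q odd_l R ιX hopen σ K' constEmb constEmb_injective hdivc hdivp).lDeltaModN
            (ofBiKummerData h toB Q odd_l R ιX hopen σ K' constEmb constEmb_injective hdivc hdivp).BN) =
        e (RD.thetaMod ⟨k, hk⟩))
    (ν : (ofBiKummerData h toB Q odd_l R ιX hopen σ K' constEmb constEmb_injective hdivc hdivp).lDeltaModN
        (ofBiKummerData h toB Q odd_l R ιX hopen σ K' constEmb constEmb_injective hdivc hdivp).BN ≃*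
      (ofBiKummerData h toB Q odd_l R ιX hopen σ K' constEmb constEmb_injective hdivc hdivp).muTorsion
        (ofBiKummerData h toB Q odd_l R ιX hopen σ K' constEmb constEmb_injective hdivc hdivp).BN
        (ofBiKummerData h toB Q odd_l R ιX hopen σ K' constEmb constEmb_injective hdivc hdivp).N)
    (hK : ∀ η : (ofBiKummerData h toB Q odd_l R ιX hopen σ K' constEmb constEmb_injective hdivc hdivp).HB →
        (ofBiKummerData h toB Q odd_l R ιX hopen σ K' constEmb constEmb_injective hdivc hdivp).lDeltaModN
          (ofBiKummerData h toB Q odd_l R ιX hopen σ K' constEmb constEmb_injective hdivc hdivp).BN,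
      (∀ k : RD.PiYdd, η ⟨rhoOfBiKummerData R ιX k, Subgroup.mem_map_of_mem _ k.2⟩ = e (η₀ k)) →
        FrobenioidThetaBiKummer.ThetaPairKummerClass
          (ofBiKummerData h toB Q odd_l R ιX hopen σ K' constEmb constEmb_injective hdivc hdivp) η ν)
    (hσ : ∀ g : Aut R.AN.base, ModelFrobenioid.baseMap (σ g).hom = g.hom)
    (hgeom : P.pre R.BN.base ≤ RD.aug.ker.map (rhoOfBiKummerData R ιX))
    (hconst : ∀ δ ∈ RD.aug.ker, ∀ τ : ModelFrobenioid.units R.BN,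
      (S.tf.ratFnFunctor.map (rhoOfBiKummerData R ιX δ).hom.op).hom (ModelFrobenioid.unit τ.1.hom) =
        ModelFrobenioid.unit τ.1.hom)
    (hreach : LinearlyReachableFromBN
      (ofBiKummerData h toB Q odd_l R ιX hopen σ K' constEmb constEmb_injective hdivc hdivp))
    (hLc : Thm56Sub.LDeltaMapComp
      (ofBiKummerData h toB Q odd_l R ιX hopen σ K' constEmb constEmb_injective hdivc hdivp))
    (hLi : Thm56Sub.LDeltaMapId
      (ofBiKummerData h toB Q odd_l R ιX hopen σ K' constEmb constEmb_injective hdivc hdivp))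
    -- leaf (G) as the base-category law (L1): Galois objects of `D` are `Aut`-torsors over every target
    (hGalT : ∀ ⦃A : D⦄, S.IsGaloisObj A → ∀ ⦃T : D⦄ (b b' : A ⟶ T), ∃ g : Aut A, b' = g.hom ≫ b)
    -- the two structural leaves that stay NAMED at the data (laws on the free stub `Q` / `P`, and on `s^⊔-gp`)
    (hproj : ∀ (g g' : Aut ((ofBiKummerData h toB Q odd_l R ιX hopen σ K' constEmb constEmb_injective hdivc hdivp).base.obj
        (ofBiKummerData h toB Q odd_l R ιX hopen σ K' constEmb constEmb_injective hdivc hdivp).BN))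
        (hh : g' ∈ P.pre _), ∃ hgh : g * g' * g⁻¹ ∈ P.pre _,
          (ofBiKummerData h toB Q odd_l R ιX hopen σ K' constEmb constEmb_injective hdivc hdivp).lDeltaMap g.hom
              (P.proj _ ⟨g', hh⟩) = P.proj _ ⟨g * g' * g⁻¹, hgh⟩)
    (hcup : ∀ (g : Aut ((ofBiKummerData h toB Q odd_l R ιX hopen σ K' constEmb constEmb_injective hdivc hdivp).base.obj
        (ofBiKummerData h toB Q odd_l R ιX hopen σ K' constEmb constEmb_injective hdivc hdivp).BN))
        (k : (ofBiKummerData h toB Q odd_l R ιX hopen σ K' constEmb constEmb_injective hdivc hdivp).HB),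
        (k : Aut ((ofBiKummerData h toB Q odd_l R ιX hopen σ K' constEmb constEmb_injective hdivc hdivp).base.obj
          (ofBiKummerData h toB Q odd_l R ιX hopen σ K' constEmb constEmb_injective hdivc hdivp).BN)) ∈ P.pre _ →
        ∃ hmem : g * (k : Aut ((ofBiKummerData h toB Q odd_l R ιX hopen σ K' constEmb constEmb_injective hdivc hdivp).base.obj
            (ofBiKummerData h toB Q odd_l R ιX hopen σ K' constEmb constEmb_injective hdivc hdivp).BN)) * g⁻¹ ∈
            (ofBiKummerData h toB Q odd_l R ιX hopen σ K' constEmb constEmb_injective hdivc hdivp).HB,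
          (ofBiKummerData h toB Q odd_l R ιX hopen σ K' constEmb constEmb_injective hdivc hdivp).sgpCup
              ⟨g * (k : Aut ((ofBiKummerData h toB Q odd_l R ιX hopen σ K' constEmb constEmb_injective hdivc hdivp).base.obj
                (ofBiKummerData h toB Q odd_l R ιX hopen σ K' constEmb constEmb_injective hdivc hdivp).BN)) * g⁻¹, hmem⟩ =
            (ofBiKummerData h toB Q odd_l R ιX hopen σ K' constEmb constEmb_injective hdivc hdivp).sgpCap g *
              (ofBiKummerData h toB Q odd_l R ιX hopen σ K' constEmb constEmb_injective hdivc hdivp).sgpCup k *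
              ((ofBiKummerData h toB Q odd_l R ιX hopen σ K' constEmb constEmb_injective hdivc hdivp).sgpCap g)⁻¹) :
    CyclotomicRigidity (ofBiKummerData h toB Q odd_l R ιX hopen σ K' constEmb constEmb_injective hdivc hdivp) P hB :=
  cyclotomicRigidity_ofBiKummerData_of_laws h toB Q odd_l R ιX hopen σ K' constEmb constEmb_injective hdivc hdivp hB P hη₀
    hdies e he hlift hpre hP ν hK hσ hgeom hconst hreach hLc hLi
    (linearBaseTorsor_ofBiKummerData_of_galoisHomTorsor h toB Q odd_l R ιX hopen σ K' constEmb constEmb_injective hdivc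
      hdivp hGalT)
    hproj hcup

end ThetaFrobenioid

end Literature.AnabelianGeometry.EtaleTheta

end
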